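import Literature.AnabelianGeometry.EtaleTheta.TemperedFrobenioidOfThetaTwistTower
import Literature.AnabelianGeometry.EtaleTheta.Discharge.Sec4BaseRootLawThetaTwistTower
import Literature.AnabelianGeometry.EtaleTheta.Discharge.Sec3Cor38OfTower
import Literature.AnabelianGeometry.EtaleTheta.Discharge.Sec3PhiZeroCountablePrimes
import Literature.AnabelianGeometry.EtaleTheta.Discharge.Sec3NonDilatingOfPfImage
import HarnessLib

/-!
# [EtTh] Ex. 3.9 (iii) «non-dilating», Prop. 3.4 (ii) (`Prop34Const`), Cor. 3.8 (i) ∧ (ii) ∧ (iii) AS TYPED (`Λ = ℤ`, NO BINDER) and the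
# A10 base root law, at the FOURTH tower model of record — the tempered Frobenioid over the FULL base `B^temp(Compat₃′)⁰` of the
# ε-free (β) Kummer tower `towerC₃sf`

S. Mochizuki, *The étale theta function …*, Publ. RIMS **45** (2009) [MochizukiEtTh2009], §3 Prop. 3.4 (i) («non-dilating») and (ii)
p.74 («`L^× ⥲ F₀(Y^log)`», «`div₀(c) = v_L(c)·div(ϖ_L)`»), Example 3.9 (iii) p.84, Cor. 3.8 (i)–(iii) pp.80–81
[cite: MochizukiEtTh2009, Cor 3.8 p.80]; §4 Def. 4.1 (ii) / Prop. 4.2 (iii) p.89; S. Mochizuki, *The geometry of Frobenioids I*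
[MochizukiFrdI2008], Def. 1.1 (i) p.19.

PROOF-ONLY (theorems only; abc-iut cell, layer L2, seat abc-iut-L2-d2 gen 7; L2-lead R1098 «COR38@FOURTH-MODEL», GO after p493549 ✓),
the sequel of this seat's `TemperedFrobenioidOfThetaTwistTower.lean` (`ThetaTwistTowerTempered.temperedFrobenioid R S`, p493549): the
exact analogue, at the FULL base and for the model whose constants carry THREE acting Kummer classes and RAMIFIED uniformisers, of this
lineage's gen-5/gen-6 files `Sec3Cor38OfTower` / `Sec3Cor38KummerTwistTower`, whose `dm`-GENERIC closers are consumed BY NAME: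
`Cor38Hyp.cor38_i/ii_ofTower_of_isFrobenioid_of_eq_mrange` (gen 5), `cor38_iii_ofRlfZWeak_of_isFrobenioid_of_countable_of_prop34Const`
(gen 4), abc-iut-f-128's `TemperedFrobenioid.isNonDilating_pull_of_pfImage`, abc-iut-w6-d058's `GaloisAction.isNonDilating_phiZeroPull`,
abc-iut-w5-d153's `countable_primes_perfection_phiZero`, and this seat's A10 `baseRootLaw_top/galois_towerC₃sf_of_full_essSurj` (p493728).
* §0 A10 AT BASE `𝟙`: `baseRootLaw_top`, `baseRootLaw_galois` — Def. 4.1 (ii) for `temperedFrobenioid R S` itself, no hypothesis.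
* §1 **Ex. 3.9 (iii) «non-dilating» with NO hypothesis** (`isNonDilating_pull`): along an ENDOmorphism the ramification index is
  `eN n n = 1`, so `Φ₀(f)` IS the plain pull-back (`Φ₀_map_hom_eq_phiZeroPull`), non-dilating by Prop. 3.4 (i).
* §2 **`prop34Const_towerC₃sf : (ofTower towerC₃sf).Prop34Const`** — census A1 at the fourth model.  NEW POINT versus the three earlier
  towers: the special-fibre divisor `d_Y` is NOT the reduced fibre `[diag]` but `[diag]^{k_Y}`, `k_Y ≥ 1` the positive GENERATOR of the
  subgroup of `ϖ̈`-exponents `{c | ∃ b ∈ F₀(Y), div₀ b = [diag]^c} ≤ ℤ` (`exponentSubgroup`; `ℤ` is cyclic — `Int.subgroup_cyclic`; it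
  contains `N_n ≠ 0` by the ramified uniformiser `ϖ = ϖ̈_n^{N_n}`): at the coverings where the `ϖ`-Kummer class acts, `ϖ̈_n ∉ F₀(Y)` and
  `k_Y > 1` — exactly print's `v_L`-normalisation «`div₀(c) = v_L(c)·div(ϖ_L)`» with a RAMIFIED `L`.  Plus `countable_primes_perfection_Φ`.
* §3 **`cor38 (h) : Cor38_i ∧ Cor38_ii ∧ Cor38_iii h`** for EVERY Cor. 3.8 datum `h` between fourth-model Frobenioids (any vocabularies
  `R S`, `R' S'`), NO binder beyond `h`; `exists_cor38Hyp_cor38` (`Ψ := 𝟭`, FSMFF from [FrdII] Ex. 1.3, non-dilating from §1).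
HONEST FRAMING: a class-(b) design model (NOT the tempered Frobenioid of a Tate curve; the (β) deviation of record stands); the typed
Cor. 3.8 (i)/(ii) carry print's slimness hypotheses INSIDE the statement (not asserted for `B^temp(Compat₃′)⁰`); nothing here bears on
[IUTchIII] Cor. 3.12; no side taken; typed ≠ proved for anything else.
-/

noncomputable section

namespace Literature.AnabelianGeometry.EtaleTheta

open CategoryTheory Opposite Function Literature.AlgebraicGeometry.Frobenioids Literature.AlgebraicGeometry.Frobenioids.QuasiTemperoid
  Literature.AnabelianGeometry.SemiGraphs LogDivisorModel LogDivisorModel.GaloisAction LogDivisorTower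

namespace ThetaTwistTowerTempered

open LogDivisorModel.TateTowerThetaTwist TateTowerKummerTwistRShear
open TateTowerKummerTwist (N eN eN_self)

variable (R S R' S' : ((ConnectedPart (BTemp (Compat 3 thetaShear)))ᵒᵖ ⥤ CommMonCat.{0}) → Prop)

/-! ## §0 A10 (Def. 4.1 (ii) root lifts) for the fourth model itself -/

/-- **A10 `BaseRootLaw ⊤` for `temperedFrobenioid R S`** (base functor `𝟙`: full, essentially surjective; E2 (a) `rootLawC₃sf`).
[cite: MochizukiEtTh2009, Prop 4.2 (iii) p.89] -/
theorem baseRootLaw_top : (ThetaTwistTowerTempered.temperedFrobenioid R S).BaseRootLaw fun _ => True :=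
  haveI := temperedFrobenioid_base_full R S
  haveI := temperedFrobenioid_base_essSurj R S
  baseRootLaw_top_towerC₃sf_of_full_essSurj (ThetaTwistTowerTempered.temperedFrobenioid R S)

/-- **A10 with `IG := «Galois»` for `temperedFrobenioid R S`**: every root lift lands in a GALOIS connected tempered covering.
[cite: MochizukiEtTh2009, Def 4.1 (ii) p.86] -/
theorem baseRootLaw_galois : (ThetaTwistTowerTempered.temperedFrobenioid R S).BaseRootLaw fun X =>
    IsGaloisObj ((ThetaTwistTowerTempered.temperedFrobenioid R S).base.obj X).obj :=
  haveI := temperedFrobenioid_base_full R S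
  haveI := temperedFrobenioid_base_essSurj R S
  baseRootLaw_galois_towerC₃sf_of_full_essSurj (ThetaTwistTowerTempered.temperedFrobenioid R S)

/-! ## §1 Example 3.9 (iii) «non-dilating» at the fourth model, NO hypothesis -/

/-- **Along an ENDOmorphism of a connected covering, `Φ₀(f)` is the plain pull-back** (the ramification index `eN n n` is `1`).
[cite: MochizukiEtTh2009, Def 3.3 (iii) p.74] -/
theorem Φ₀_map_hom_eq_phiZeroPull {Y : (ConnectedPart (BTemp (Compat 3 thetaShear)))ᵒᵖ} (f : Y ⟶ Y) (ψ : dm.Φ₀.obj Y) :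
    (dm.Φ₀.map f).hom ψ = (TateTowerTheta.action φ₃).phiZeroPull f.unop.hom.hom ψ := by
  rw [Φ₀_map_hom_eq, eN_self, pow_one]

/-- **Prop. 3.4 (i) «non-dilating» for the transition of `Φ₀` along every endomorphism** (abc-iut-w6-d058's orbit argument
`isNonDilating_phiZeroPull`, through §1's identification). [cite: MochizukiEtTh2009, Prop 3.4 p.74] -/
theorem isNonDilating_Φ₀_map {Y : (ConnectedPart (BTemp (Compat 3 thetaShear)))ᵒᵖ} (f : Y ⟶ Y) : IsNonDilating (dm.Φ₀.map f).hom := by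
  have h : (dm.Φ₀.map f).hom = (TateTowerTheta.action φ₃).phiZeroPull f.unop.hom.hom :=
    MonoidHom.ext fun ψ => Φ₀_map_hom_eq_phiZeroPull f ψ
  rw [h]
  exact GaloisAction.isNonDilating_phiZeroPull _ _ _

/-- **Example 3.9 (iii) «non-dilating» at the fourth model with NO hypothesis**: the pull-back of `Φ` along EVERY endomorphism of EVERY
connected tempered covering is non-dilating ([FrdI] Def. 1.1 (i); abc-iut-f-128's reduction to `Φ₀`). [cite: MochizukiEtTh2009, Ex 3.9 p.84] -/
theorem isNonDilating_pull (A : (ConnectedPart (BTemp (Compat 3 thetaShear)))ᵒᵖ) (f : A ⟶ A) :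
    treeMonoidVocabWeak.{0}.IsNonDilating ((ThetaTwistTowerTempered.temperedFrobenioid R S).Φ.carrier A)
      ((ThetaTwistTowerTempered.temperedFrobenioid R S).Φ.pull f) :=
  (ThetaTwistTowerTempered.temperedFrobenioid R S).isNonDilating_pull_of_pfImage (fun _ _ => Iff.rfl) A f (isNonDilating_Φ₀_map _)

/-! ## §2 `Prop34Const` at the fourth model: the special-fibre divisor is `[diag]^{k_Y}`, `k_Y` the generator of the exponent subgroup -/

section Level

variable (n : ℕ) {S : Action (Type 0) (Compat 3 thetaShear)}

/-- **The subgroup of `ϖ̈`-exponents of the constants of a covering**: `{c ∈ ℤ | ∃ b ∈ F₀(S), div₀ b = [diag]^c}` — a subgroup because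
`F₀(S)` is a group (Prop. 3.4 (ii)) and `div₀` a homomorphism. [cite: MochizukiEtTh2009, Prop 3.4 p.74] -/
theorem exists_exponentSubgroup (S : Action (Type 0) (Compat 3 thetaShear)) : ∃ H : AddSubgroup ℤ, ∀ c : ℤ, c ∈ H ↔
    ∃ b ∈ (towerC₃sf.act n).fZero S,
      (towerC₃sf.act n).divZeroHom S b = Algebra.GrothendieckGroup.of (TateTowerTheta.diag φ₃ S) ^ c :=
  ⟨{ carrier := {c | ∃ b ∈ (towerC₃sf.act n).fZero S,
        (towerC₃sf.act n).divZeroHom S b = Algebra.GrothendieckGroup.of (TateTowerTheta.diag φ₃ S) ^ c}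
     zero_mem' := ⟨1, one_mem _, (map_one _).trans (zpow_zero _).symm⟩
     add_mem' := by
       rintro c c' ⟨b, hb, hbc⟩ ⟨b', hb', hbc'⟩
       refine ⟨b * b', mul_mem hb hb', ?_⟩
       rw [map_mul, hbc, hbc']
       exact (zpow_add _ c c').symm
     neg_mem' := by
       rintro c ⟨b, hb, hbc⟩
       refine ⟨b⁻¹, (towerC₃sf.act n).inv_mem_fZero S hb, ?_⟩
       rw [map_inv, hbc]
       exact (zpow_neg _ c).symm }, fun _ => Iff.rfl⟩

/-- **The exponent subgroup is `k ℤ` with `k ≥ 1` ATTAINED by a constant** (`ℤ` cyclic; `N_n ∈` it by the ramified uniformiser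
`ϖ = ϖ̈_n^{N_n} ∈ F₀(S)`): there are `k ≥ 1` and `ϖ_S ∈ F₀(S)` with `div₀ ϖ_S = [diag]^k`, and `div₀` of every constant is a power of
`[diag]^k` — print's «`div₀(c) = v_L(c)·div(ϖ_L)`» with `div(ϖ_L) = k·Σ_j[F_j]`, `k` the ramification of `L`.
[cite: MochizukiEtTh2009, Prop 3.4 p.74] -/
theorem exists_generator_fZero (hS : isConnectedGSet S) : ∃ k : ℕ, 0 < k ∧
    (∃ ϖ ∈ (towerC₃sf.act n).fZero S,
      (towerC₃sf.act n).divZeroHom S ϖ = Algebra.GrothendieckGroup.of (TateTowerTheta.diag φ₃ S) ^ (k : ℤ)) ∧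
    ∀ b ∈ (towerC₃sf.act n).fZero S, ∃ m : ℤ,
      (towerC₃sf.act n).divZeroHom S b = Algebra.GrothendieckGroup.of (TateTowerTheta.diag φ₃ S) ^ ((k : ℤ) * m) := by
  obtain ⟨H, hH⟩ := exists_exponentSubgroup n S
  obtain ⟨a, rfl⟩ := Int.subgroup_cyclic H
  -- `N_n` is an exponent, so the generator is nonzero
  have hN : ((N n : ℕ) : ℤ) ∈ AddSubgroup.closure ({a} : Set ℤ) :=
    (hH _).2 ⟨unifPowFam n S, unifPowFam_mem_fZero n S, divZeroHom_unifPowFam n S⟩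
  have ha0 : a ≠ 0 := by
    rintro rfl
    obtain ⟨m, hm⟩ := AddSubgroup.mem_closure_singleton.1 hN
    rw [smul_zero] at hm
    exact absurd hm.symm (Int.natCast_ne_zero.mpr (PNat.ne_zero _))
  -- `|a|` lies in the subgroup and divides every exponent
  have habs : (a.natAbs : ℤ) ∈ AddSubgroup.closure ({a} : Set ℤ) := by
    rcases Int.natAbs_eq a with h | h
    · rw [← h]; exact AddSubgroup.subset_closure (Set.mem_singleton a)
    · rw [Int.eq_neg_comm.mp h]; exact neg_mem (AddSubgroup.subset_closure (Set.mem_singleton a))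
  refine ⟨a.natAbs, Int.natAbs_pos.mpr ha0, (hH _).1 habs, fun b hb => ?_⟩
  obtain ⟨c, hc⟩ := Subgroup.mem_zpowers_iff.1 (divZeroHom_mem_zpowers_of_mem_fZero n hS hb)
  obtain ⟨m, hm⟩ := AddSubgroup.mem_closure_singleton.1 ((hH c).2 ⟨b, hb, hc.symm⟩)
  obtain ⟨m', rfl⟩ : (a.natAbs : ℤ) ∣ c := Int.natAbs_dvd.mpr (Dvd.intro_left m ((smul_eq_mul ..).symm.trans hm))
  exact ⟨m', hc.symm⟩

/-- **Clause (b) of `Prop34Const` at every connected covering of the fourth model**: `d := [diag]^{k_S}` is non-cuspidal, `≠ 1`,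
attained as `div₀ ϖ_S`, and `div₀ b ∈ d^ℤ` for every constant `b`. [cite: MochizukiEtTh2009, Prop 3.4 p.74] -/
theorem exists_specialFibre_towerC₃sf (hS : isConnectedGSet S) :
    ∃ d ∈ (towerC₃sf.act n).ncspZero S, d ≠ 1 ∧
      (∃ ϖ ∈ (towerC₃sf.act n).fZero S, (towerC₃sf.act n).divZeroHom S ϖ = Algebra.GrothendieckGroup.of d) ∧
      ∀ b ∈ (towerC₃sf.act n).fZero S, ∃ m : ℤ, (towerC₃sf.act n).divZeroHom S b = Algebra.GrothendieckGroup.of d ^ m := by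
  obtain ⟨k, hk, ⟨ϖ, hϖ, hϖd⟩, hall⟩ := exists_generator_fZero n hS
  haveI : Nonempty S.V := hS.1
  have hd : TateTowerTheta.diag φ₃ S ∈ (towerC₃sf.act n).ncspZero S := fun _ _ => rfl
  -- `[diag]^k = [diag^k]` in `Φ₀(S)^gp`
  have hpow : Algebra.GrothendieckGroup.of (TateTowerTheta.diag φ₃ S) ^ (k : ℤ) =
      (Algebra.GrothendieckGroup.of (TateTowerTheta.diag φ₃ S ^ k) : Algebra.GrothendieckGroup ((towerC₃sf.act n).phiZero S)) :=
    (zpow_natCast _ k).trans (map_pow _ _ k).symm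
  refine ⟨TateTowerTheta.diag φ₃ S ^ k, Submonoid.pow_mem _ hd k,
    fun h => TateTowerTheta.diag_ne_one φ₃ S (TateTowerTheta.pow_left_injective φ₃ S hk (h.trans (one_pow k).symm)),
    ⟨ϖ, hϖ, hϖd.trans hpow⟩, fun b hb => ?_⟩
  obtain ⟨m, hm⟩ := hall b hb
  exact ⟨m, hm.trans ((zpow_mul _ (k : ℤ) m).trans (congrArg (· ^ m) hpow))⟩

end Level

/-- **[EtTh] Prop. 3.4 (ii), abc-iut-L2-t3's bundle `Prop34Const` (census A1), HOLDS at the ε-free theta tower `towerC₃sf`**, at every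
connected tempered covering — with the RAMIFIED special-fibre divisor `[diag]^{k_Y}`. [cite: MochizukiEtTh2009, Prop 3.4 p.74] -/
theorem prop34Const_towerC₃sf : (DivisorMonoids.ofTower towerC₃sf).Prop34Const where
  inv_mem_F₀ Y b hb := (towerC₃sf.act (lvlC 3 thetaShear Y.unop)).exists_inv_mem_fZero (gset Y.unop) b hb
  exists_specialFibre Y := exists_specialFibre_towerC₃sf (lvlC 3 thetaShear Y.unop) (isConnectedGSet_gset Y.unop)

/-- **`Prime(Φ₀(Y)^pf)` is countable at every connected tempered covering of the fourth model** (countable orbit, cusps `ℤ × Bool`,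
components `ℤ`; abc-iut-w5-d153). [cite: MochizukiEtTh2009, Rmk 3.3.1 p.73] -/
theorem countable_primes_perfection_Φ₀ (Y : (ConnectedPart (BTemp (Compat 3 thetaShear)))ᵒᵖ) :
    Countable (Primes (Perfection ↥(dm.Φ₀.obj Y))) := by
  haveI : Countable (gset Y.unop).V := Y.unop.obj.property.1
  haveI : Countable (towerC₃sf.Z (lvlC 3 thetaShear Y.unop)).Cusp := show Countable (ℤ × Bool) from inferInstance
  haveI : Countable (towerC₃sf.Z (lvlC 3 thetaShear Y.unop)).Comp := show Countable ℤ from inferInstance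
  exact countable_primes_perfection_phiZero (towerC₃sf.act (lvlC 3 thetaShear Y.unop)) (gset Y.unop)

/-- **`hcnt` at the fourth model**: `Prime(Φ(A)^pf)` is countable (`Φ(A) ≅ Φ₀(A)^pf`). [cite: MochizukiEtTh2009, Ex 3.9 p.84] -/
theorem countable_primes_perfection_Φ (A : (ConnectedPart (BTemp (Compat 3 thetaShear)))ᵒᵖ) :
    Countable (Primes (Perfection ↥((ThetaTwistTowerTempered.temperedFrobenioid R S).Φ.carrier A))) := by
  have hM := hpf A
  haveI := countable_primes_perfection_Φ₀ A
  haveI : Countable (Primes ↥(MonoidHom.mrange hM.weak.toRealification)) :=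
    countable_primes_of_mulEquiv (MulEquiv.ofBijective _ (PfImageWeak.mrangeRestrict_toRealification_bijective hM.weak))
  exact (PfImageWeak.isPerfFactorialCof_mrange_toRealification hM).weak.countable_primes_perfection

/-! ## §3 Cor. 3.8 (i) ∧ (ii) ∧ (iii) at the fourth model, NO binder -/

/-- **[EtTh] Cor. 3.8 (iii), first clause (`Λ = ℤ`), at the fourth model with NO binder**: for EVERY Cor. 3.8 datum `h`, `Cor38_iii h`
(`hcnt`, `Prop34Const`, «`C` is a Frobenioid» all theorems here; abc-iut-L2-d2 gen 4's apex). [cite: MochizukiEtTh2009, Cor 3.8 p.81] -/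
theorem cor38_iii (h : Cor38Hyp (ThetaTwistTowerTempered.temperedFrobenioid R S) (ThetaTwistTowerTempered.temperedFrobenioid R' S')) : Cor38_iii h :=
  cor38_iii_ofRlfZWeak_of_isFrobenioid_of_countable_of_prop34Const h (countable_primes_perfection_Φ R S)
    (countable_primes_perfection_Φ R' S') prop34Const_towerC₃sf prop34Const_towerC₃sf (isFrobenioid_temperedFrobenioid R S)
    (isFrobenioid_temperedFrobenioid R' S')

/-- **[EtTh] Cor. 3.8 (i) AS TYPED, monoid type `ℤ`, at the fourth model, NO binder beyond `h`** (gen 5's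
`cor38_i_ofTower_of_isFrobenioid_of_eq_mrange`; the Φ-tie is `rfl`). [cite: MochizukiEtTh2009, Cor 3.8 p.80] -/
theorem cor38_i (h : Cor38Hyp (ThetaTwistTowerTempered.temperedFrobenioid R S) (ThetaTwistTowerTempered.temperedFrobenioid R' S')) :
    Literature.AnabelianGeometry.EtaleTheta.Cor38_i (fun E _ => Literature.AlgebraicGeometry.Frobenioids.IsFrobeniusSlim E) h :=
  h.cor38_i_ofTower_of_isFrobenioid_of_eq_mrange (isFrobenioid_temperedFrobenioid R S) (isFrobenioid_temperedFrobenioid R' S')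
    (fun _ => rfl) (fun _ => rfl) prop34Const_towerC₃sf prop34Const_towerC₃sf

/-- **[EtTh] Cor. 3.8 (ii) AS TYPED, monoid type `ℤ`, at the fourth model, NO binder beyond `h`.** [cite: MochizukiEtTh2009, Cor 3.8 p.81] -/
theorem cor38_ii (h : Cor38Hyp (ThetaTwistTowerTempered.temperedFrobenioid R S) (ThetaTwistTowerTempered.temperedFrobenioid R' S')) :
    Literature.AnabelianGeometry.EtaleTheta.Cor38_ii
      (fun E _ Φ => ∀ (B : E) (α : Aut (Over.forget B)),
        (∀ (B' : Over B) (x : Φ.obj (op B'.left)), Literature.AlgebraicGeometry.Frobenioids.pull Φ (α.hom.app B') x = x) → α = 1) h :=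
  h.cor38_ii_ofTower_of_isFrobenioid_of_eq_mrange (isFrobenioid_temperedFrobenioid R S) (isFrobenioid_temperedFrobenioid R' S')
    (fun _ => rfl) (fun _ => rfl) prop34Const_towerC₃sf prop34Const_towerC₃sf

/-- **[EtTh] Cor. 3.8 (i) ∧ (ii) ∧ (iii) AS TYPED, monoid type `ℤ`, at the tempered Frobenioid over the FULL base of the ε-free theta
tower, for every `h`, NO binder beyond `h`.** [cite: MochizukiEtTh2009, Cor 3.8 p.80] -/
theorem cor38 (h : Cor38Hyp (ThetaTwistTowerTempered.temperedFrobenioid R S) (ThetaTwistTowerTempered.temperedFrobenioid R' S')) :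
    Literature.AnabelianGeometry.EtaleTheta.Cor38_i (fun E _ => Literature.AlgebraicGeometry.Frobenioids.IsFrobeniusSlim E) h ∧
      Literature.AnabelianGeometry.EtaleTheta.Cor38_ii
        (fun E _ Φ => ∀ (B : E) (α : Aut (Over.forget B)),
          (∀ (B' : Over B) (x : Φ.obj (op B'.left)), Literature.AlgebraicGeometry.Frobenioids.pull Φ (α.hom.app B') x = x) → α = 1) h ∧
      Cor38_iii h :=
  ⟨cor38_i R S R' S' h, cor38_ii R S R' S' h, cor38_iii R S R' S' h⟩

/-- **The Cor. 3.8 datum is INHABITED at the fourth model** (`Ψ := 𝟭`; `B^temp(Compat₃′)⁰` is of FSMFF type by [FrdII] Ex. 1.3 (i);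
`Φ` non-dilating by §1). [cite: MochizukiEtTh2009, Cor 3.8 p.80] -/
theorem nonempty_cor38Hyp : Nonempty (Cor38Hyp (ThetaTwistTowerTempered.temperedFrobenioid R S) (ThetaTwistTowerTempered.temperedFrobenioid R S)) :=
  ⟨{ Ψ := CategoryTheory.Equivalence.refl
     fsmff := ⟨BTempConnected.connectedPart_isOfFSMType.isOfFSMFFType, BTempConnected.connectedPart_isOfFSMType.isOfFSMFFType⟩
     nonDilating := ⟨isNonDilating_pull R S, isNonDilating_pull R S⟩ }⟩

/-- **The typed statements of the nodes `EtTh:Cor3.8(i)`, `(ii)`, `(iii)` have a SIMULTANEOUS unconditional kernel instance at the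
FOURTH tower model** — full base, cusps, theta roots, level-wise roots of unity, three acting Kummer classes, ramified uniformisers.
[cite: MochizukiEtTh2009, Cor 3.8 p.80] -/
theorem exists_cor38Hyp_cor38 :
    ∃ h : Cor38Hyp (ThetaTwistTowerTempered.temperedFrobenioid R S) (ThetaTwistTowerTempered.temperedFrobenioid R S),
      Literature.AnabelianGeometry.EtaleTheta.Cor38_i (fun E _ => Literature.AlgebraicGeometry.Frobenioids.IsFrobeniusSlim E) h ∧
        Literature.AnabelianGeometry.EtaleTheta.Cor38_ii
          (fun E _ Φ => ∀ (B : E) (α : Aut (Over.forget B)),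
            (∀ (B' : Over B) (x : Φ.obj (op B'.left)), Literature.AlgebraicGeometry.Frobenioids.pull Φ (α.hom.app B') x = x) → α = 1) h ∧
        Cor38_iii h := by
  obtain ⟨h⟩ := nonempty_cor38Hyp R S
  exact ⟨h, cor38 R S R S h⟩

end ThetaTwistTowerTempered

end Literature.AnabelianGeometry.EtaleTheta

end
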